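import Summits.QuantumFields.YangMills.Theorems.BalabanUVNodesN15TwoGridOutputSwap
import HarnessLib

/-!
# Route «BalabanUVNodes», node N15 = NE2, -a lane, part 61: THE L²-BLOCK NORM AS A `B11SectG.BlockNorm`, ITS COMPARISON WITH THE SUP-BLOCK NORM, AND THE
# DUALITY TRANSFER `HasMaj (L² → L²) S K ⇒ HasMaj (sup → L²) T Kᵀ` FOR AN ADJOINT PAIR `(T, S)` (entry 2 of [B9] (3.42), first file)

Cell `pub-ymgap`, seat `pub-ymgap-dag-n15-a` (KNIT-BY-NAME, g13); `--supports stmt-QuantumFields-20507 --as helper` (one plumbing `def`: the gate may route it to the definition lane).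
WHY.  Entry 2 of [B9] (3.42) for Bałaban's pair `(G′, G)` at `U ≡ 1` is `T2 = 𝔇(G∇*) = G′∇′*_νP − PG∇*_ν` with the derivative on the ROUGH coarse SOURCE; no sup-only route
exists in the tree's currency ((1.112)∕(1.113) need Hölder sources; `∇G∇*`, `G∇*∇` are not bounded on `ℓ^∞`).  The route of record (this seat, g13): (a) the weighted ADJOINT
`S = T2† = R∇′_νG′ − ∇_νGR` (`R = P†` = King's block average) is an entry-1-type operator whose consistency defects are controlled in `L²` by Bałaban's (1.114) (`‖ζ∇∇GJ‖`,
`‖ζ∇G∇*J‖`) and, for the Landau and averaging pieces, by DUALITY BACK to the tree's sup-currency theorems (parts 45∕53); (b) `HasMaj (sup → L²) T2` from `S` by the pairing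
`⟨g, T2μ⟩_{η′} = ⟨Sg, μ⟩_η` and Cauchy–Schwarz on a unit block; (c) `sup` from `L²` by interpolation with the (1.111) oscillation of `G∇*`.  THIS FILE types the currency of (a)–(b).
CONTENTS.  §78 `sqrt_sum_sq_add_le` (Minkowski on a finset), ★ `BlockNorm.l2Blocks g blk w` (`loc y f = √(w·Σ_{blk x = y} f(x)²)`, sharp cut `blockPiece`, `κ = 1`), unfolding lemmas.
§79 `sq_le_loc_l2Blocks_sq`, `loc_l2Blocks_le_of_pointwise`, ★ `loc_l2Blocks_le_sqrt_mul_loc_ofBlocks` (`L² ≤ √(w·#block)·sup`), ★ `weighted_sum_abs_le` (`w·Σ_{block}|f| ≤ √(w·#block)·L²`,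
Cauchy–Schwarz), `HasMaj.to_l2Blocks` (every sup-block majorant is a (sup → L²) majorant up to `√ω`).  §80 ★★ `hasMaj_of_adjoint` (the duality transfer for an adjoint pair with weights
`w₁`, `w₂` and `w₁·#block ≤ ω`: `HasMaj (l2Blocks₂) (l2Blocks₁) S K ⇒ HasMaj (ofBlocks₁) (l2Blocks₂) T (√ω·Kᵀ)`).
HONEST FRAMING ∕ LIMITS.  Finite-dimensional bookkeeping ([folklore]); NO estimate of [B5]∕[B9]; the (1.114) unpacking, the adjoint identities of `P`, `G`, `∇`, the operator `S` and
the interpolation are the sequels; count-neutral (typed 28∕28 · discharged 5∕27 of record unchanged); NOT a discharge of N15 (object-bound; NE2⁺ NOT PRINTED); one finite T⁴ at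
fixed ε — NOT infinite volume, NOT OS on ℝ⁴, NOT a mass gap, NOT Clay.
-/

noncomputable section

open scoped BigOperators
open Finset

namespace Summit.QuantumFields.YangMills.BalabanUVNodes.N15.TwoGrid

open Literature.MathematicalPhysics.QuantumFieldTheory.Balaban1983to89
open Literature.MathematicalPhysics.QuantumFieldTheory.Balaban1983to89.B11SectG (BlockNorm HasMaj hasMaj_zero)
open Literature.MathematicalPhysics.QuantumFieldTheory.Balaban1983to89.B11AxialTransport190 (abs_le_loc_ofBlocks loc_ofBlocks_le)
open Literature.MathematicalPhysics.QuantumFieldTheory.Balaban1983to89.B6RandomWalk (blockPiece sum_blockPiece)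

/-! ## §78 The L²-block norm -/

section L2

variable {X : Type} [Fintype X]

/-- **MINKOWSKI ON A FINSET**: `√(Σ (f+g)²) ≤ √(Σ f²) + √(Σ g²)` (from the Cauchy–Schwarz inequality `Real.sum_mul_le_sqrt_mul_sqrt`). [folklore] -/
private theorem sqrt_sum_sq_add_le {ι : Type*} (s : Finset ι) (f g : ι → ℝ) :
    Real.sqrt (∑ i ∈ s, (f i + g i) ^ 2) ≤ Real.sqrt (∑ i ∈ s, f i ^ 2) + Real.sqrt (∑ i ∈ s, g i ^ 2) := by
  have hA : 0 ≤ ∑ i ∈ s, f i ^ 2 := sum_nonneg fun _ _ => sq_nonneg _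
  have hB : 0 ≤ ∑ i ∈ s, g i ^ 2 := sum_nonneg fun _ _ => sq_nonneg _
  have hCS : ∑ i ∈ s, f i * g i ≤ Real.sqrt (∑ i ∈ s, f i ^ 2) * Real.sqrt (∑ i ∈ s, g i ^ 2) := Real.sum_mul_le_sqrt_mul_sqrt s f g
  have hexp : ∑ i ∈ s, (f i + g i) ^ 2 = ∑ i ∈ s, f i ^ 2 + ∑ i ∈ s, g i ^ 2 + 2 * ∑ i ∈ s, f i * g i := by
    rw [mul_sum, ← sum_add_distrib, ← sum_add_distrib]
    exact sum_congr rfl fun i _ => by ring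
  rw [Real.sqrt_le_left (add_nonneg (Real.sqrt_nonneg _) (Real.sqrt_nonneg _)), hexp]
  nlinarith [Real.sq_sqrt hA, Real.sq_sqrt hB, Real.sqrt_nonneg (∑ i ∈ s, f i ^ 2), Real.sqrt_nonneg (∑ i ∈ s, g i ^ 2)]

variable (g : B6.Geometry) [DecidableEq g.Site] (blk : X → g.Site) (w : ℝ)

/-- ★ **THE L²-BLOCK NORM** on lattice functions `X → ℝ` with a weight `w ≥ 0` per point (`w = η^D` for the `η`-lattice): `loc y f = √(w·Σ_{x : blk x = y} f(x)²)`, the sharp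
block restriction `blockPiece` as `cut` (`κ = 1`), "vanishes off the block of `y′`" as `IsLoc` — a `B11SectG.BlockNorm`, so the lineage's `HasMaj` calculus (composition, sums,
row sums) applies verbatim to (sup → L²) and (L² → L²) majorants. [cite: Balaban1984PropagatorsI, Prop. 1.2 (1.114) p.36 (the ζ-cut L² norms)] -/
def BlockNorm.l2Blocks (hw : 0 ≤ w) : BlockNorm g (X → ℝ) := by
  refine
    { loc := fun y f => Real.sqrt (w * ∑ x ∈ univ.filter (fun x => blk x = y), f x ^ 2)
      cut := fun y =>
        { toFun := blockPiece blk y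
          map_add' := fun f f' => by
            funext x; by_cases hx : blk x = y <;> simp [blockPiece, hx]
          map_smul' := fun c f => by
            funext x; by_cases hx : blk x = y <;> simp [blockPiece, hx] }
      IsLoc := fun y μ => ∀ x, blk x ≠ y → μ x = 0
      κ := 1
      κ_nonneg := zero_le_one
      loc_nonneg := fun y f => Real.sqrt_nonneg _
      loc_zero := fun y => by simp
      loc_add_le := fun y f f' => ?_
      loc_neg := fun y f => by simp
      sum_cut := fun f => sum_blockPiece blk f
      isLoc_cut := fun y f x hx => by simp [blockPiece, hx]
      loc_cut_le := fun y f => ?_ }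
  · -- Minkowski with the weight pulled in
    have hw' : Real.sqrt w * Real.sqrt w = w := Real.mul_self_sqrt hw
    have e : ∀ h : X → ℝ, Real.sqrt (w * ∑ x ∈ univ.filter (fun x => blk x = y), h x ^ 2)
        = Real.sqrt (∑ x ∈ univ.filter (fun x => blk x = y), (Real.sqrt w * h x) ^ 2) := fun h => by
      congr 1; rw [mul_sum]; exact sum_congr rfl fun x _ => by rw [mul_pow, Real.sq_sqrt hw]
    show Real.sqrt (w * ∑ x ∈ univ.filter (fun x => blk x = y), (f + f') x ^ 2) ≤ _
    rw [e, e, e]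
    simpa only [Pi.add_apply, mul_add] using sqrt_sum_sq_add_le (univ.filter (fun x => blk x = y)) (fun x => Real.sqrt w * f x) (fun x => Real.sqrt w * f' x)
  · show Real.sqrt (w * ∑ x ∈ univ.filter (fun x => blk x = y), blockPiece blk y f x ^ 2) ≤ 1 * Real.sqrt (w * ∑ x ∈ univ.filter (fun x => blk x = y), f x ^ 2)
    rw [one_mul]
    refine le_of_eq (congrArg Real.sqrt (congrArg (w * ·) (sum_congr rfl fun x hx => ?_)))
    rw [mem_filter] at hx
    simp [blockPiece, hx.2]

variable {g blk w}

/-- unfolding of the L²-block size. [folklore] -/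
theorem loc_l2Blocks_eq (hw : 0 ≤ w) (y : g.Site) (f : X → ℝ) :
    (BlockNorm.l2Blocks g blk w hw).loc y f = Real.sqrt (w * ∑ x ∈ univ.filter (fun x => blk x = y), f x ^ 2) := rfl

/-- unfolding of the localisation predicate (the same as the sup-block norm's). [folklore] -/
theorem isLoc_l2Blocks_iff (hw : 0 ≤ w) (y : g.Site) (μ : X → ℝ) :
    (BlockNorm.l2Blocks g blk w hw).IsLoc y μ ↔ ∀ x, blk x ≠ y → μ x = 0 := Iff.rfl

/-- unfolding of the cut: the sharp block restriction. [folklore] -/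
theorem cut_l2Blocks_apply (hw : 0 ≤ w) (y : g.Site) (f : X → ℝ) (x : X) :
    (BlockNorm.l2Blocks g blk w hw).cut y f x = blockPiece blk y f x := rfl

/-- the cutting constant is `1`. [folklore] -/
theorem κ_l2Blocks (hw : 0 ≤ w) : (BlockNorm.l2Blocks g blk w hw).κ = 1 := rfl

/-! ## §79 Comparison with the sup-block norm; Cauchy–Schwarz on a block -/

/-- the block sum of squares under the L² size: `w·Σ_{block y} f² = loc²`. [folklore] -/
theorem sq_loc_l2Blocks (hw : 0 ≤ w) (y : g.Site) (f : X → ℝ) :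
    (BlockNorm.l2Blocks g blk w hw).loc y f ^ 2 = w * ∑ x ∈ univ.filter (fun x => blk x = y), f x ^ 2 := by
  rw [loc_l2Blocks_eq hw, Real.sq_sqrt (mul_nonneg hw (sum_nonneg fun _ _ => sq_nonneg _))]

/-- **L² FROM POINTWISE**: if `|f x| ≤ a` on the block of `y` (`a ≥ 0`) then `loc y f ≤ √(w·#block)·a`. [folklore] -/
theorem loc_l2Blocks_le_of_pointwise (hw : 0 ≤ w) (y : g.Site) (f : X → ℝ) {a : ℝ} (ha : 0 ≤ a)
    (h : ∀ x, blk x = y → |f x| ≤ a) :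
    (BlockNorm.l2Blocks g blk w hw).loc y f ≤ Real.sqrt (w * ((univ.filter (fun x => blk x = y)).card : ℝ)) * a := by
  rw [loc_l2Blocks_eq hw, ← Real.sqrt_sq ha, ← Real.sqrt_mul (mul_nonneg hw (Nat.cast_nonneg _))]
  refine Real.sqrt_le_sqrt ?_
  rw [mul_assoc]
  refine mul_le_mul_of_nonneg_left ?_ hw
  calc ∑ x ∈ univ.filter (fun x => blk x = y), f x ^ 2 ≤ ∑ x ∈ univ.filter (fun x => blk x = y), a ^ 2 :=
        sum_le_sum fun x hx => by
          rw [mem_filter] at hx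
          have := h x hx.2
          rw [← sq_abs]
          exact pow_le_pow_left₀ (abs_nonneg _) this 2
    _ = ((univ.filter (fun x => blk x = y)).card : ℝ) * a ^ 2 := by rw [sum_const, nsmul_eq_mul]

/-- ★ **`L² ≤ √(w·#block)·sup`**: the L²-block size is at most `√(w·#block)` times the sup-block size (`= sup` when `w·#block ≤ 1`, e.g. `w = η^D` and `#block = η^{−D}`). [folklore] -/
theorem loc_l2Blocks_le_sqrt_mul_loc_ofBlocks (hw : 0 ≤ w) (y : g.Site) (f : X → ℝ) :
    (BlockNorm.l2Blocks g blk w hw).loc y f ≤ Real.sqrt (w * ((univ.filter (fun x => blk x = y)).card : ℝ)) * (BlockNorm.ofBlocks g blk).loc y f :=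
  loc_l2Blocks_le_of_pointwise hw y f ((BlockNorm.ofBlocks g blk).loc_nonneg y f) fun _ hx => abs_le_loc_ofBlocks blk f hx

/-- ★ **CAUCHY–SCHWARZ ON A BLOCK**: `w·Σ_{block y}|f|·|h| ≤ loc y f · loc y h`. [folklore] -/
theorem weighted_sum_abs_mul_le (hw : 0 ≤ w) (y : g.Site) (f h : X → ℝ) :
    w * ∑ x ∈ univ.filter (fun x => blk x = y), |f x| * |h x| ≤ (BlockNorm.l2Blocks g blk w hw).loc y f * (BlockNorm.l2Blocks g blk w hw).loc y h := by
  rw [loc_l2Blocks_eq hw, loc_l2Blocks_eq hw, ← Real.sqrt_mul (mul_nonneg hw (sum_nonneg fun _ _ => sq_nonneg _))]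
  have hCS := Real.sum_mul_le_sqrt_mul_sqrt (univ.filter (fun x => blk x = y)) (fun x => |f x|) (fun x => |h x|)
  simp only [sq_abs] at hCS
  have hS : 0 ≤ ∑ x ∈ univ.filter (fun x => blk x = y), f x ^ 2 := sum_nonneg fun _ _ => sq_nonneg _
  have hS' : 0 ≤ ∑ x ∈ univ.filter (fun x => blk x = y), h x ^ 2 := sum_nonneg fun _ _ => sq_nonneg _
  have e : (w * ∑ x ∈ univ.filter (fun x => blk x = y), f x ^ 2) * (w * ∑ x ∈ univ.filter (fun x => blk x = y), h x ^ 2)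
      = w ^ 2 * ((∑ x ∈ univ.filter (fun x => blk x = y), f x ^ 2) * ∑ x ∈ univ.filter (fun x => blk x = y), h x ^ 2) := by ring
  rw [e, Real.sqrt_mul (sq_nonneg w), Real.sqrt_sq hw, Real.sqrt_mul hS]
  exact mul_le_mul_of_nonneg_left hCS hw

/-- **`w·Σ_{block}|f| ≤ √(w·#block)·loc y f`** (Cauchy–Schwarz against the constant `1`). [folklore] -/
theorem weighted_sum_abs_le (hw : 0 ≤ w) (y : g.Site) (f : X → ℝ) :
    w * ∑ x ∈ univ.filter (fun x => blk x = y), |f x| ≤ Real.sqrt (w * ((univ.filter (fun x => blk x = y)).card : ℝ)) * (BlockNorm.l2Blocks g blk w hw).loc y f := by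
  have h := weighted_sum_abs_mul_le (blk := blk) hw y (fun _ => (1 : ℝ)) f
  simp only [abs_one, one_mul] at h
  refine h.trans (le_of_eq ?_)
  congr 1
  rw [loc_l2Blocks_eq hw]
  simp

/-- **EVERY SUP-BLOCK MAJORANT IS A (sup → L²) MAJORANT** up to `√ω`, `ω ≥ w·#block` for every block. [folklore] -/
theorem HasMaj.to_l2Blocks {F₁ : Type} [AddCommGroup F₁] [Module ℝ F₁] {b₁ : BlockNorm g F₁} {T : F₁ →ₗ[ℝ] (X → ℝ)}
    {K : g.Site → g.Site → ℝ} (hw : 0 ≤ w) {ω : ℝ} (hω : ∀ y, w * ((univ.filter (fun x => blk x = y)).card : ℝ) ≤ ω)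
    (h : HasMaj b₁ (BlockNorm.ofBlocks g blk) T K) : HasMaj b₁ (BlockNorm.l2Blocks g blk w hw) T (fun y y' => Real.sqrt ω * K y y') := by
  intro y' μ hμ y
  refine (loc_l2Blocks_le_sqrt_mul_loc_ofBlocks hw y (T μ)).trans ?_
  rw [mul_assoc]
  exact mul_le_mul (Real.sqrt_le_sqrt (hω y)) (h y' μ hμ y) ((BlockNorm.ofBlocks g blk).loc_nonneg y (T μ)) (Real.sqrt_nonneg _)

end L2

/-! ## §80 ★★ The duality transfer for an adjoint pair -/

section Duality

variable {X₁ X₂ : Type} [Fintype X₁] [Fintype X₂] {g : B6.Geometry} [DecidableEq g.Site] {blk₁ : X₁ → g.Site} {blk₂ : X₂ → g.Site} {w₁ w₂ : ℝ}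

/-- ★★ **DUALITY**: let `T : (X₁ → ℝ) → (X₂ → ℝ)` and `S : (X₂ → ℝ) → (X₁ → ℝ)` be ADJOINT for the weights `w₁, w₂` (`w₂·Σ g·Tμ = w₁·Σ (Sg)·μ`), `w₁·#block₁ ≤ ω`.  If `S` has the
(L² → L²) block majorant `K` (`K ≥ 0`) then `T` has the (sup → L²) block majorant `(y, y′) ↦ √ω·K(y′, y)`: `loc₂(y, Tμ)² = ⟨cut_y Tμ, Tμ⟩ = ⟨S(cut_y Tμ), μ⟩ ≤ √ω·loc₁(y′, S cut_y Tμ)·sup|μ|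
≤ √ω·K(y′,y)·loc₂(y, Tμ)·sup|μ|`. [folklore] -/
theorem hasMaj_of_adjoint (hw₁ : 0 ≤ w₁) (hw₂ : 0 ≤ w₂) {ω : ℝ} (hω : ∀ y, w₁ * ((univ.filter (fun x => blk₁ x = y)).card : ℝ) ≤ ω)
    {T : (X₁ → ℝ) →ₗ[ℝ] (X₂ → ℝ)} {S : (X₂ → ℝ) →ₗ[ℝ] (X₁ → ℝ)}
    (hadj : ∀ (μ : X₁ → ℝ) (f : X₂ → ℝ), w₂ * ∑ x₂, f x₂ * T μ x₂ = w₁ * ∑ x₁, S f x₁ * μ x₁)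
    {K : g.Site → g.Site → ℝ} (hK : ∀ y y', 0 ≤ K y y')
    (hS : HasMaj (BlockNorm.l2Blocks g blk₂ w₂ hw₂) (BlockNorm.l2Blocks g blk₁ w₁ hw₁) S K) :
    HasMaj (BlockNorm.ofBlocks g blk₁) (BlockNorm.l2Blocks g blk₂ w₂ hw₂) T (fun y y' => Real.sqrt ω * K y' y) := by
  classical
  intro y' μ hμ y
  set b₂ := BlockNorm.l2Blocks g blk₂ w₂ hw₂ with hb₂
  set b₁ := BlockNorm.l2Blocks g blk₁ w₁ hw₁ with hb₁
  set f : X₂ → ℝ := blockPiece blk₂ y (T μ) with hf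
  have hRHS : 0 ≤ Real.sqrt ω * K y' y * (BlockNorm.ofBlocks g blk₁).loc y' μ :=
    mul_nonneg (mul_nonneg (Real.sqrt_nonneg _) (hK y' y)) ((BlockNorm.ofBlocks g blk₁).loc_nonneg y' μ)
  -- `loc₂(y, Tμ)² = w₂ Σ f·Tμ`
  have hsq : b₂.loc y (T μ) ^ 2 = w₂ * ∑ x₂, f x₂ * T μ x₂ := by
    rw [hb₂, sq_loc_l2Blocks hw₂, ← sum_filter_add_sum_filter_not univ (fun x => blk₂ x = y) (fun x₂ => f x₂ * T μ x₂)]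
    have h0 : ∑ x ∈ univ.filter (fun x => ¬blk₂ x = y), f x * T μ x = 0 :=
      sum_eq_zero fun x hx => by rw [mem_filter] at hx; simp [hf, blockPiece, hx.2]
    rw [h0, add_zero]
    congr 1
    exact sum_congr rfl fun x hx => by rw [mem_filter] at hx; simp [hf, blockPiece, hx.2, sq]
  -- `… = w₁ Σ (Sf)·μ ≤ √ω · loc₁(y′, Sf) · sup|μ|`
  have hloc_f : b₂.loc y f = b₂.loc y (T μ) := by
    rw [hb₂, loc_l2Blocks_eq hw₂, loc_l2Blocks_eq hw₂]
    congr 1; congr 1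
    exact sum_congr rfl fun x hx => by rw [mem_filter] at hx; simp [hf, blockPiece, hx.2]
  have hfloc : b₂.IsLoc y f := fun x hx => by simp [hf, blockPiece, hx]
  have hpair : w₁ * ∑ x₁, S f x₁ * μ x₁ ≤ Real.sqrt ω * b₁.loc y' (S f) * (BlockNorm.ofBlocks g blk₁).loc y' μ := by
    rw [← sum_filter_add_sum_filter_not univ (fun x => blk₁ x = y') (fun x₁ => S f x₁ * μ x₁)]
    have h0 : ∑ x ∈ univ.filter (fun x => ¬blk₁ x = y'), S f x * μ x = 0 :=
      sum_eq_zero fun x hx => by rw [mem_filter] at hx; rw [hμ x hx.2, mul_zero]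
    rw [h0, add_zero]
    calc w₁ * ∑ x ∈ univ.filter (fun x => blk₁ x = y'), S f x * μ x
        ≤ w₁ * ∑ x ∈ univ.filter (fun x => blk₁ x = y'), |S f x| * (BlockNorm.ofBlocks g blk₁).loc y' μ := by
          refine mul_le_mul_of_nonneg_left (sum_le_sum fun x hx => ?_) hw₁
          rw [mem_filter] at hx
          calc S f x * μ x ≤ |S f x * μ x| := le_abs_self _
            _ = |S f x| * |μ x| := abs_mul _ _
            _ ≤ |S f x| * (BlockNorm.ofBlocks g blk₁).loc y' μ := mul_le_mul_of_nonneg_left (abs_le_loc_ofBlocks blk₁ μ hx.2) (abs_nonneg _)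
      _ = (w₁ * ∑ x ∈ univ.filter (fun x => blk₁ x = y'), |S f x|) * (BlockNorm.ofBlocks g blk₁).loc y' μ := by rw [← sum_mul]; ring
      _ ≤ (Real.sqrt ω * b₁.loc y' (S f)) * (BlockNorm.ofBlocks g blk₁).loc y' μ := by
          refine mul_le_mul_of_nonneg_right ?_ ((BlockNorm.ofBlocks g blk₁).loc_nonneg y' μ)
          exact (weighted_sum_abs_le hw₁ y' (S f)).trans (mul_le_mul_of_nonneg_right (Real.sqrt_le_sqrt (hω y')) (b₁.loc_nonneg y' _))
  have hSf : b₁.loc y' (S f) ≤ K y' y * b₂.loc y f := hS y f hfloc y'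
  -- `loc² ≤ (√ω K loc_sup) · loc`, hence `loc ≤ √ω K loc_sup`
  have hkey : b₂.loc y (T μ) ^ 2 ≤ (Real.sqrt ω * K y' y * (BlockNorm.ofBlocks g blk₁).loc y' μ) * b₂.loc y (T μ) := by
    rw [hsq, hadj]
    refine hpair.trans ?_
    rw [← hloc_f]
    have := mul_le_mul_of_nonneg_left hSf (mul_nonneg (Real.sqrt_nonneg ω) ((BlockNorm.ofBlocks g blk₁).loc_nonneg y' μ))
    nlinarith [this, hK y' y, Real.sqrt_nonneg ω, (BlockNorm.ofBlocks g blk₁).loc_nonneg y' μ, b₂.loc_nonneg y f]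
  by_cases h0 : b₂.loc y (T μ) = 0
  · rw [h0]; exact hRHS
  · have hpos : 0 < b₂.loc y (T μ) := lt_of_le_of_ne (b₂.loc_nonneg y _) (Ne.symm h0)
    exact le_of_mul_le_mul_right (by rw [sq] at hkey; linarith [hkey]) hpos

end Duality

end Summit.QuantumFields.YangMills.BalabanUVNodes.N15.TwoGrid
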